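import Mathlib.Tactic.FinCases
import Literature.Analysis.FunctionSpaces.PVTheoryProofs
import Literature.Computability.MetaComplexity.BoundedArithRelabel
import Literature.Computability.MetaComplexity.BoundedArithDefinability
import HarnessLib

/-!
# `Σᵇᵢ(PV)`-definability with parameters in an `L(PV)`-structure, and `PIND` / `IND` for
definable predicates

Companion of `PVTheory.lean` (the language `L(PV)`, the classes `Σᵇᵢ(PV) / Πᵇᵢ(PV)`, the theories
`S₂ⁱ(PV)`, `T₂ⁱ(PV)`), parallel — clause by clause — to the files
`Literature/Computability/MetaComplexity/BoundedArithRelabel.lean`, `BoundedArithModels.lean` and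
`BoundedArithDefinability.lean`, which do the same for Buss's original language `L(S₂)`.  This is
the infrastructure for arguing *inside an arbitrary model* `M` of `S₂ⁱ(PV)` / `T₂ⁱ(PV)` (which is how
"`S₂ⁱ⁺¹(PV)` proves every axiom of `T₂ⁱ(PV)`", Mathlib's semantic `⊨ᵇ`, has to be established):

* the `L(S₂)`-reduct `pvReduct M` of an `L(PV)`-structure (Mathlib `LHom.reduct` along the
  embedding `boundedArithToPV`; a `def` used as a *local* instance only), so that the operations
  `mZero, mSucc, mHalf, mLen, mAdd, mMul, mSmash, MLe` of `BoundedArithModels.lean` — and, in a model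
  of (translated) `BASIC`, the whole algebraic toolkit `BASICModel` — are available on `M`;
* `realize` lemmas for the `L(PV)` term formers and for the induction axioms `pvIndAxiom`,
  `pvPindAxiom` in an arbitrary structure (in `PVTheory.lean` they are stated for `ℕ` only);
* stability of `IsSharplyBoundedPV`, `IsSigmabPV`, `IsPibPV` under `BoundedFormula.relabel` and
  `BoundedFormula.subst` (Buss 1986, §2.1: the classes are closed under renaming of variables and
  term substitution; simultaneous induction over the generating clauses);
* definability with parameters from `M`: `IsPVTermFn F`, `IsQFPVDef P`, `IsSigmabPVDef i P`,
  `IsPibPVDef i P` (parameters are named by themselves: defining formulas have free variables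
  `M ⊕ Fin m`, exactly as in `BoundedArithDefinability.lean`), with the closure properties
  mirroring the generating clauses of the classes;
* **`Σᵇᵢ(PV)-PIND`** (`IsSigmabPVDef.pinduction'`) and **`Σᵇᵢ(PV)-IND`** (`IsSigmabPVDef.induction'`)
  for definable unary predicates with parameters, in a structure satisfying the scheme
  `⋃ k, pvPindAxiom '' sigmabPVFormulas i k` (resp. `pvIndAxiom`), in particular in models of
  `S2PV i` / `T2PV i` (Buss 1986, §2.4 and Ch. 6, Definitions of `S₂ⁱ(PV)`, `T₂ⁱ(PV)`).

## References

* S. R. Buss, *Bounded Arithmetic*, Bibliopolis 1986, §2.1 (formulas with parameters; closure of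
  `Σᵇᵢ / Πᵇᵢ` under term substitution), §2.4, Ch. 6 (`S₂ⁱ(PV)`).
* J. Krajíček, *Bounded Arithmetic, Propositional Logic and Complexity Theory*, CUP 1995, §5.2,
  §5.3 (p. 73: `S₂¹(PV)`).

## Design choices

* `pvReduct` is a definition, made a *local* instance in this file (and in its users): a global
  instance `Language.pv.Structure M → Language.boundedArith.Structure M` would put a second
  `L(S₂)`-structure on `ℕ` (besides `instStructureNatBoundedArith`).  On the reduct,
  `boundedArithToPV.IsExpansionOn M` holds by Mathlib's `LHom.isExpansionOn_reduct`.
* Generic lemmas of the `L(S₂)` development that do not depend on the language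
  (`relabel_ballLE`, `subst_bexLE`, `realize_closeFin`, `realize_congr_freeVarFinset`, …) are
  reused, not restated; only the clauses mentioning the `L(PV)` term former `|·|` (`pvLen`) and
  the `L(PV)` classes are redone.
* Structures live in `Type`, as in `BoundedArithModels.lean` and Mathlib's `⊨ᵇ` for this language.
-/

namespace Literature.Analysis.FunctionSpaces

open FirstOrder FirstOrder.Language FirstOrder.Language.BoundedFormula
open Literature.Computability.MetaComplexity (ballLE bexLE relabel_ballLE relabel_bexLE subst_ballLE
  subst_bexLE isQF_subst subst_imp closeFin allLast instLast substLast realize_closeFin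
  realize_allLast realize_instLast realize_substLast mZero mSucc mHalf mLen mAdd mMul mSmash MLe
  realize_congr_freeVarFinset)

/-! ## The `L(S₂)`-reduct of an `L(PV)`-structure -/

/-- The `L(S₂)`-reduct of an `L(PV)`-structure `M`: Buss's symbols `0, S, ⌊·/2⌋, |·|, +, ·, #, ≤`
are interpreted through the embedding `boundedArithToPV` (Mathlib `LHom.reduct`; Buss 1986,
Ch. 6: `L(S₂) ⊆ L(PV)`).  A definition, used as a local instance only (see the module
docstring). [cite: Buss1986, Ch. 6] -/
@[reducible] def pvReduct (M : Type) [Language.pv.Structure M] : Language.boundedArith.Structure M :=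
  boundedArithToPV.reduct M

/-- The embedding `L(S₂) →ᴸ L(PV)` is an expansion on the reduct (Mathlib
`LHom.isExpansionOn_reduct`). [folklore] -/
theorem isExpansionOn_pvReduct (M : Type) [Language.pv.Structure M] :
    @LHom.IsExpansionOn _ _ boundedArithToPV M (pvReduct M) _ :=
  LHom.isExpansionOn_reduct _ _

attribute [local instance] pvReduct isExpansionOn_pvReduct

section Reduct

variable {M : Type} [Language.pv.Structure M]

/-- An `L(PV)`-structure is a model of a translated `L(S₂)`-theory iff its reduct is a model of
the theory (Mathlib `LHom.onTheory_model`). [folklore] -/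
theorem model_onTheory_boundedArithToPV_iff' (T : Language.boundedArith.Theory) :
    M ⊨ boundedArithToPV.onTheory T ↔ M ⊨ T :=
  LHom.onTheory_model boundedArithToPV T

/-- Truth of a translated `L(S₂)`-formula in an `L(PV)`-structure is truth in the reduct
(Mathlib `LHom.realize_onFormula`). [folklore] -/
theorem realize_onFormula_boundedArithToPV' {α : Type} (φ : Language.boundedArith.Formula α)
    (v : α → M) : (boundedArithToPV.onFormula φ).Realize v ↔ φ.Realize v :=
  LHom.realize_onFormula boundedArithToPV φ

/-! ### The `L(PV)` term formers in a structure -/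

variable {β : Type} (v : β → M) (t t₁ t₂ : Language.pv.Term β)

/-- Semantics of the term `0` of `L(PV)` in a structure. [folklore] -/
@[simp] theorem realize_pv_zero' : (0 : Language.pv.Term β).realize v = mZero M := by
  show Structure.funMap (L := Language.pv) PVFun.zero _ =
    Structure.funMap (L := Language.pv) PVFun.zero _
  congr 1
  exact Subsingleton.elim _ _

/-- Semantics of `S t` (`pvSucc`) in a structure. [folklore] -/
@[simp] theorem realize_pvSucc' : (pvSucc t).realize v = mSucc (t.realize v) := by
  rw [pvSucc, Term.realize_functions_apply₁]; rfl

/-- Semantics of `⌊t/2⌋` (`pvHalf`) in a structure. [folklore] -/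
@[simp] theorem realize_pvHalf' : (pvHalf t).realize v = mHalf (t.realize v) := by
  rw [pvHalf, Term.realize_functions_apply₁]; rfl

/-- Semantics of `|t|` (`pvLen`) in a structure. [folklore] -/
@[simp] theorem realize_pvLen' : (pvLen t).realize v = mLen (t.realize v) := by
  rw [pvLen, Term.realize_functions_apply₁]; rfl

/-- Semantics of the `L(PV)`-term `t₁ + t₂` in a structure (the `L(PV)` counterpart of
`realize_term_add`, which is about `L(S₂)`-terms: same shape, different language). [folklore] -/
@[simp] theorem realize_pv_add' : (t₁ + t₂).realize v = mAdd (t₁.realize v) (t₂.realize v) := by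
  show (Functions.apply₂ (L := Language.pv) PVFun.add t₁ t₂).realize v = _
  rw [Term.realize_functions_apply₂]; rfl

/-- Semantics of the `L(PV)`-term `t₁ · t₂` in a structure (the `L(PV)` counterpart of
`realize_term_mul`). [folklore] -/
@[simp] theorem realize_pv_mul' : (t₁ * t₂).realize v = mMul (t₁.realize v) (t₂.realize v) := by
  show (Functions.apply₂ (L := Language.pv) PVFun.mul t₁ t₂).realize v = _
  rw [Term.realize_functions_apply₂]; rfl

/-- Semantics of `t₁ # t₂` (`pvSmash`) in a structure. [folklore] -/
@[simp] theorem realize_pvSmash' :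
    (pvSmash t₁ t₂).realize v = mSmash (t₁.realize v) (t₂.realize v) := by
  rw [pvSmash, Term.realize_functions_apply₂]; rfl

/-- Semantics of the atomic formula `s₁ ≤ s₂` of `L(PV)` in a structure. [folklore] -/
@[simp] theorem realize_le_pv' {n : ℕ} (w : β → M) (xs : Fin n → M)
    (s₁ s₂ : Language.pv.Term (β ⊕ Fin n)) :
    (Term.le s₁ s₂).Realize w xs ↔
      MLe (s₁.realize (Sum.elim w xs)) (s₂.realize (Sum.elim w xs)) := by
  rw [Term.le, realize_rel₂]
  rfl

/-- Semantics of the bounded universal quantifier of `L(PV)` in a structure. [folklore] -/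
@[simp] theorem realize_ballLE_pv' {n : ℕ} (s : Language.pv.Term (β ⊕ Fin n))
    (φ : Language.pv.BoundedFormula β (n + 1)) (w : β → M) (xs : Fin n → M) :
    (ballLE s φ).Realize w xs ↔
      ∀ a, MLe a (s.realize (Sum.elim w xs)) → φ.Realize w (Fin.snoc xs a) := by
  simp [ballLE, Sum.elim_comp_map]

/-- Semantics of the bounded existential quantifier of `L(PV)` in a structure. [folklore] -/
@[simp] theorem realize_bexLE_pv' {n : ℕ} (s : Language.pv.Term (β ⊕ Fin n))
    (φ : Language.pv.BoundedFormula β (n + 1)) (w : β → M) (xs : Fin n → M) :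
    (bexLE s φ).Realize w xs ↔
      ∃ a, MLe a (s.realize (Sum.elim w xs)) ∧ φ.Realize w (Fin.snoc xs a) := by
  simp [bexLE, Sum.elim_comp_map]

/-! ### The induction axioms over `L(PV)` in a structure -/

variable {k : ℕ}

/-- What the induction axiom `IND(φ)` over `L(PV)` says in a structure: for all parameters `p̄`,
if `φ(p̄, 0)` and `∀a (φ(p̄, a) → φ(p̄, S a))` then `∀a φ(p̄, a)` (Buss 1986, §2.3, Ch. 6).
[cite: Buss1986, §2.3] -/
theorem realize_pvIndAxiom_iff (φ : Language.pv.Formula (Fin (k + 1))) :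
    M ⊨ pvIndAxiom φ ↔ ∀ p : Fin k → M,
      φ.Realize (Fin.snoc p (mZero M)) →
        (∀ a, φ.Realize (Fin.snoc p a) → φ.Realize (Fin.snoc p (mSucc a))) →
          ∀ a, φ.Realize (Fin.snoc p a) := by
  rw [pvIndAxiom, realize_closeFin]
  refine forall_congr' fun p => ?_
  simp only [Formula.realize_imp, Formula.realize_inf, realize_instLast, realize_allLast,
    realize_substLast, realize_pv_zero', realize_pvSucc', pvLastVar, Term.realize_var,
    Fin.snoc_last, Fin.update_snoc_last, and_imp]

/-- What the polynomial induction axiom `PIND(φ)` over `L(PV)` says in a structure: for all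
parameters `p̄`, if `φ(p̄, 0)` and `∀a (φ(p̄, ⌊a/2⌋) → φ(p̄, a))` then `∀a φ(p̄, a)`
(Buss 1986, §2.3, Ch. 6). [cite: Buss1986, §2.3] -/
theorem realize_pvPindAxiom_iff (φ : Language.pv.Formula (Fin (k + 1))) :
    M ⊨ pvPindAxiom φ ↔ ∀ p : Fin k → M,
      φ.Realize (Fin.snoc p (mZero M)) →
        (∀ a, φ.Realize (Fin.snoc p (mHalf a)) → φ.Realize (Fin.snoc p a)) →
          ∀ a, φ.Realize (Fin.snoc p a) := by
  rw [pvPindAxiom, realize_closeFin]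
  refine forall_congr' fun p => ?_
  simp only [Formula.realize_imp, Formula.realize_inf, realize_instLast, realize_allLast,
    realize_substLast, realize_pv_zero', realize_pvHalf', pvLastVar, Term.realize_var,
    Fin.snoc_last, Fin.update_snoc_last, and_imp]

end Reduct

/-! ## Small closure properties of the classes `Σᵇᵢ(PV) / Πᵇᵢ(PV)` -/

section Hierarchy

variable {α : Type} {n : ℕ}

/-- `⊥` is a sharply bounded `L(PV)`-formula (it is quantifier-free) (Buss 1986, §2.1, Ch. 6).
[cite: Buss1986, §2.1] -/
theorem IsSharplyBoundedPV.falsum :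
    IsSharplyBoundedPV (⊥ : Language.pv.BoundedFormula α n) :=
  .of_isQF .falsum

/-- Sharply bounded `L(PV)`-formulas are closed under negation (Buss 1986, §2.1, Ch. 6).
[cite: Buss1986, §2.1] -/
theorem IsSharplyBoundedPV.not {φ : Language.pv.BoundedFormula α n}
    (h : IsSharplyBoundedPV φ) : IsSharplyBoundedPV (∼φ) :=
  h.imp .falsum

/-- Negations of `Πᵇᵢ₊₁(PV)` formulas are `Σᵇᵢ₊₁(PV)` (Buss 1986, §2.1, Ch. 6). [cite: Buss1986, §2.1] -/
theorem IsPibPV.not {i : ℕ} {φ : Language.pv.BoundedFormula α n}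
    (h : IsPibPV (i + 1) φ) : IsSigmabPV (i + 1) (∼φ) :=
  .imp h (.of_isSharplyBoundedPV .falsum)

/-- Negations of `Σᵇᵢ₊₁(PV)` formulas are `Πᵇᵢ₊₁(PV)` (Buss 1986, §2.1, Ch. 6). [cite: Buss1986, §2.1] -/
theorem IsSigmabPV.not {i : ℕ} {φ : Language.pv.BoundedFormula α n}
    (h : IsSigmabPV (i + 1) φ) : IsPibPV (i + 1) (∼φ) :=
  .imp h (.of_isSharplyBoundedPV .falsum)

/-- `Σᵇᵢ₊₁(PV)` is closed under `∧` (`φ ⊓ ψ = ∼(φ ⟹ ∼ψ)` on Mathlib syntax) (Buss 1986, §2.1,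
Ch. 6). [cite: Buss1986, §2.1] -/
theorem IsSigmabPV.inf {i : ℕ} {φ ψ : Language.pv.BoundedFormula α n}
    (hφ : IsSigmabPV (i + 1) φ) (hψ : IsSigmabPV (i + 1) ψ) : IsSigmabPV (i + 1) (φ ⊓ ψ) :=
  (IsPibPV.imp hφ hψ.not).not

/-- `Σᵇᵢ₊₁(PV)` is closed under `∨` (`φ ⊔ ψ = ∼φ ⟹ ψ`) (Buss 1986, §2.1, Ch. 6). [cite: Buss1986, §2.1] -/
theorem IsSigmabPV.sup {i : ℕ} {φ ψ : Language.pv.BoundedFormula α n}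
    (hφ : IsSigmabPV (i + 1) φ) (hψ : IsSigmabPV (i + 1) ψ) : IsSigmabPV (i + 1) (φ ⊔ ψ) :=
  .imp hφ.not hψ

/-- `Πᵇᵢ₊₁(PV)` is closed under `∧` (Buss 1986, §2.1, Ch. 6). [cite: Buss1986, §2.1] -/
theorem IsPibPV.inf {i : ℕ} {φ ψ : Language.pv.BoundedFormula α n}
    (hφ : IsPibPV (i + 1) φ) (hψ : IsPibPV (i + 1) ψ) : IsPibPV (i + 1) (φ ⊓ ψ) :=
  (IsSigmabPV.imp hφ hψ.not).not

end Hierarchy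

/-! ## `Σᵇᵢ(PV) / Πᵇᵢ(PV)` are stable under relabelling of variables -/

section Relabel

variable {α β : Type} {m n : ℕ}

/-- Relabelling commutes with the length term former `|·|` of `L(PV)`. [folklore] -/
private theorem relabel_pvLen {γ δ : Type} (r : γ → δ) (t : Language.pv.Term γ) :
    (pvLen t).relabel r = pvLen (t.relabel r) := by
  simp only [pvLen, Functions.apply₁, Term.relabel]
  congr 1
  funext j
  fin_cases j
  rfl

/-- Relabelling commutes with the sharply bounded universal quantifier of `L(PV)`. [folklore] -/
@[simp] theorem relabel_ballLELenPV (g : α → β ⊕ Fin m) (t : Language.pv.Term (α ⊕ Fin n))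
    (φ : Language.pv.BoundedFormula α (n + 1)) :
    (ballLELenPV t φ).relabel g = ballLELenPV (t.relabel (relabelAux g n)) (φ.relabel g) := by
  simp only [ballLELenPV, relabel_ballLE, relabel_pvLen]

/-- Relabelling commutes with the sharply bounded existential quantifier of `L(PV)`. [folklore] -/
@[simp] theorem relabel_bexLELenPV (g : α → β ⊕ Fin m) (t : Language.pv.Term (α ⊕ Fin n))
    (φ : Language.pv.BoundedFormula α (n + 1)) :
    (bexLELenPV t φ).relabel g = bexLELenPV (t.relabel (relabelAux g n)) (φ.relabel g) := by
  simp only [bexLELenPV, relabel_bexLE, relabel_pvLen]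

/-- Sharply bounded `L(PV)`-formulas are stable under relabelling of variables (Buss 1986, §2.1,
Ch. 6: the classes are closed under renaming of variables). [cite: Buss1986, §2.1] -/
theorem IsSharplyBoundedPV.relabel {φ : Language.pv.BoundedFormula α n}
    (h : IsSharplyBoundedPV φ) :
    ∀ {m : ℕ} (g : α → β ⊕ Fin m), IsSharplyBoundedPV (φ.relabel g) := by
  induction h with
  | of_isQF h => exact fun g => .of_isQF (h.relabel g)
  | imp _ _ ih₁ ih₂ =>
    intro m g
    rw [relabel_imp]
    exact .imp (ih₁ g) (ih₂ g)
  | ballLELenPV t _ ih =>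
    intro m g
    rw [relabel_ballLELenPV]
    exact .ballLELenPV _ (ih g)
  | bexLELenPV t _ ih =>
    intro m g
    rw [relabel_bexLELenPV]
    exact .bexLELenPV _ (ih g)

/-- `Σᵇᵢ(PV)` and `Πᵇᵢ(PV)` are stable under relabelling of variables (Buss 1986, §2.1, Ch. 6;
simultaneous induction over the generating clauses). [cite: Buss1986, §2.1] -/
theorem IsSigmabPV.relabel_and_IsPibPV_relabel (i : ℕ) :
    (∀ {n : ℕ} {φ : Language.pv.BoundedFormula α n}, IsSigmabPV i φ →
      ∀ {m : ℕ} (g : α → β ⊕ Fin m), IsSigmabPV i (φ.relabel g)) ∧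
    (∀ {n : ℕ} {φ : Language.pv.BoundedFormula α n}, IsPibPV i φ →
      ∀ {m : ℕ} (g : α → β ⊕ Fin m), IsPibPV i (φ.relabel g)) := by
  constructor
  · intro n φ h
    refine IsSigmabPV.rec
      (motive_1 := fun i n φ _ => ∀ {m : ℕ} (g : α → β ⊕ Fin m), IsSigmabPV i (φ.relabel g))
      (motive_2 := fun i n φ _ => ∀ {m : ℕ} (g : α → β ⊕ Fin m), IsPibPV i (φ.relabel g))
      ?_ ?_ ?_ ?_ ?_ ?_ ?_ ?_ ?_ ?_ h
    · exact fun h _ g => .of_isSharplyBoundedPV (h.relabel g)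
    · exact fun _ ih _ g => .of_isPibPV (ih g)
    · intro i n φ ψ _ _ ih₁ ih₂ m g
      rw [relabel_imp]
      exact .imp (ih₁ g) (ih₂ g)
    · intro i n t φ _ ih m g
      rw [relabel_bexLE]
      exact .bexLE _ (ih g)
    · intro i n t φ _ ih m g
      rw [relabel_ballLELenPV]
      exact .ballLELenPV _ (ih g)
    · exact fun h _ g => .of_isSharplyBoundedPV (h.relabel g)
    · exact fun _ ih _ g => .of_isSigmabPV (ih g)
    · intro i n φ ψ _ _ ih₁ ih₂ m g
      rw [relabel_imp]
      exact .imp (ih₁ g) (ih₂ g)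
    · intro i n t φ _ ih m g
      rw [relabel_ballLE]
      exact .ballLE _ (ih g)
    · intro i n t φ _ ih m g
      rw [relabel_bexLELenPV]
      exact .bexLELenPV _ (ih g)
  · intro n φ h
    refine IsPibPV.rec
      (motive_1 := fun i n φ _ => ∀ {m : ℕ} (g : α → β ⊕ Fin m), IsSigmabPV i (φ.relabel g))
      (motive_2 := fun i n φ _ => ∀ {m : ℕ} (g : α → β ⊕ Fin m), IsPibPV i (φ.relabel g))
      ?_ ?_ ?_ ?_ ?_ ?_ ?_ ?_ ?_ ?_ h
    · exact fun h _ g => .of_isSharplyBoundedPV (h.relabel g)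
    · exact fun _ ih _ g => .of_isPibPV (ih g)
    · intro i n φ ψ _ _ ih₁ ih₂ m g
      rw [relabel_imp]
      exact .imp (ih₁ g) (ih₂ g)
    · intro i n t φ _ ih m g
      rw [relabel_bexLE]
      exact .bexLE _ (ih g)
    · intro i n t φ _ ih m g
      rw [relabel_ballLELenPV]
      exact .ballLELenPV _ (ih g)
    · exact fun h _ g => .of_isSharplyBoundedPV (h.relabel g)
    · exact fun _ ih _ g => .of_isSigmabPV (ih g)
    · intro i n φ ψ _ _ ih₁ ih₂ m g
      rw [relabel_imp]
      exact .imp (ih₁ g) (ih₂ g)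
    · intro i n t φ _ ih m g
      rw [relabel_ballLE]
      exact .ballLE _ (ih g)
    · intro i n t φ _ ih m g
      rw [relabel_bexLELenPV]
      exact .bexLELenPV _ (ih g)

/-- `Σᵇᵢ(PV)` is stable under relabelling of variables (Buss 1986, §2.1, Ch. 6). [cite: Buss1986, §2.1] -/
theorem IsSigmabPV.relabel {i : ℕ} {φ : Language.pv.BoundedFormula α n}
    (h : IsSigmabPV i φ) (g : α → β ⊕ Fin m) : IsSigmabPV i (φ.relabel g) :=
  (IsSigmabPV.relabel_and_IsPibPV_relabel i).1 h g

/-- `Πᵇᵢ(PV)` is stable under relabelling of variables (Buss 1986, §2.1, Ch. 6). [cite: Buss1986, §2.1] -/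
theorem IsPibPV.relabel {i : ℕ} {φ : Language.pv.BoundedFormula α n}
    (h : IsPibPV i φ) (g : α → β ⊕ Fin m) : IsPibPV i (φ.relabel g) :=
  (IsSigmabPV.relabel_and_IsPibPV_relabel i).2 h g

/-- `Σᵇᵢ(PV)` is stable under renaming the free variables of a formula (`Formula.relabel`)
(Buss 1986, §2.1, Ch. 6). [cite: Buss1986, §2.1] -/
theorem IsSigmabPV.formulaRelabel {i : ℕ} {φ : Language.pv.Formula α} (h : IsSigmabPV i φ)
    (g : α → β) : IsSigmabPV i (φ.relabel g) :=
  h.relabel _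

/-- `Πᵇᵢ(PV)` is stable under renaming the free variables of a formula (`Formula.relabel`)
(Buss 1986, §2.1, Ch. 6). [cite: Buss1986, §2.1] -/
theorem IsPibPV.formulaRelabel {i : ℕ} {φ : Language.pv.Formula α} (h : IsPibPV i φ)
    (g : α → β) : IsPibPV i (φ.relabel g) :=
  h.relabel _

end Relabel

/-! ## `Σᵇᵢ(PV) / Πᵇᵢ(PV)` are stable under substitution of terms for the free variables -/

section Subst

variable {α β : Type} {n : ℕ}

/-- Substitution commutes with the length term former `|·|` of `L(PV)`. [folklore] -/
private theorem subst_pvLen {γ δ : Type} (τ : γ → Language.pv.Term δ) (t : Language.pv.Term γ) :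
    (pvLen t).subst τ = pvLen (t.subst τ) := by
  simp only [pvLen, Functions.apply₁, Term.subst]
  congr 1
  funext j
  fin_cases j
  rfl

/-- Substitution commutes with the sharply bounded universal quantifier of `L(PV)`. [folklore] -/
@[simp] theorem subst_ballLELenPV (σ : α → Language.pv.Term β) (t : Language.pv.Term (α ⊕ Fin n))
    (φ : Language.pv.BoundedFormula α (n + 1)) :
    (ballLELenPV t φ).subst σ =
      ballLELenPV (t.subst (Sum.elim (Term.relabel Sum.inl ∘ σ) (var ∘ Sum.inr))) (φ.subst σ) := by
  simp only [ballLELenPV, subst_ballLE, subst_pvLen]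

/-- Substitution commutes with the sharply bounded existential quantifier of `L(PV)`. [folklore] -/
@[simp] theorem subst_bexLELenPV (σ : α → Language.pv.Term β) (t : Language.pv.Term (α ⊕ Fin n))
    (φ : Language.pv.BoundedFormula α (n + 1)) :
    (bexLELenPV t φ).subst σ =
      bexLELenPV (t.subst (Sum.elim (Term.relabel Sum.inl ∘ σ) (var ∘ Sum.inr))) (φ.subst σ) := by
  simp only [bexLELenPV, subst_bexLE, subst_pvLen]

/-- Sharply bounded `L(PV)`-formulas are stable under substitution of terms for the free
variables (Buss 1986, §2.1, Ch. 6: closure under term substitution). [cite: Buss1986, §2.1] -/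
theorem IsSharplyBoundedPV.subst {φ : Language.pv.BoundedFormula α n}
    (h : IsSharplyBoundedPV φ) (σ : α → Language.pv.Term β) :
    IsSharplyBoundedPV (φ.subst σ) := by
  induction h with
  | of_isQF h => exact .of_isQF (isQF_subst h σ)
  | imp _ _ ih₁ ih₂ =>
    rw [subst_imp]
    exact .imp ih₁ ih₂
  | ballLELenPV t _ ih =>
    rw [subst_ballLELenPV]
    exact .ballLELenPV _ ih
  | bexLELenPV t _ ih =>
    rw [subst_bexLELenPV]
    exact .bexLELenPV _ ih

/-- `Σᵇᵢ(PV)` and `Πᵇᵢ(PV)` are stable under substitution of terms for the free variables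
(Buss 1986, §2.1, Ch. 6; simultaneous induction). [cite: Buss1986, §2.1] -/
theorem IsSigmabPV.subst_and_IsPibPV_subst (i : ℕ) (σ : α → Language.pv.Term β) :
    (∀ {n : ℕ} {φ : Language.pv.BoundedFormula α n}, IsSigmabPV i φ →
      IsSigmabPV i (φ.subst σ)) ∧
    (∀ {n : ℕ} {φ : Language.pv.BoundedFormula α n}, IsPibPV i φ →
      IsPibPV i (φ.subst σ)) := by
  constructor
  · intro n φ h
    refine IsSigmabPV.rec
      (motive_1 := fun i n φ _ => IsSigmabPV i (φ.subst σ))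
      (motive_2 := fun i n φ _ => IsPibPV i (φ.subst σ))
      ?_ ?_ ?_ ?_ ?_ ?_ ?_ ?_ ?_ ?_ h
    · exact fun h => .of_isSharplyBoundedPV (h.subst σ)
    · exact fun _ ih => .of_isPibPV ih
    · intro i n φ ψ _ _ ih₁ ih₂
      rw [subst_imp]
      exact .imp ih₁ ih₂
    · intro i n t φ _ ih
      rw [subst_bexLE]
      exact .bexLE _ ih
    · intro i n t φ _ ih
      rw [subst_ballLELenPV]
      exact .ballLELenPV _ ih
    · exact fun h => .of_isSharplyBoundedPV (h.subst σ)
    · exact fun _ ih => .of_isSigmabPV ih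
    · intro i n φ ψ _ _ ih₁ ih₂
      rw [subst_imp]
      exact .imp ih₁ ih₂
    · intro i n t φ _ ih
      rw [subst_ballLE]
      exact .ballLE _ ih
    · intro i n t φ _ ih
      rw [subst_bexLELenPV]
      exact .bexLELenPV _ ih
  · intro n φ h
    refine IsPibPV.rec
      (motive_1 := fun i n φ _ => IsSigmabPV i (φ.subst σ))
      (motive_2 := fun i n φ _ => IsPibPV i (φ.subst σ))
      ?_ ?_ ?_ ?_ ?_ ?_ ?_ ?_ ?_ ?_ h
    · exact fun h => .of_isSharplyBoundedPV (h.subst σ)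
    · exact fun _ ih => .of_isPibPV ih
    · intro i n φ ψ _ _ ih₁ ih₂
      rw [subst_imp]
      exact .imp ih₁ ih₂
    · intro i n t φ _ ih
      rw [subst_bexLE]
      exact .bexLE _ ih
    · intro i n t φ _ ih
      rw [subst_ballLELenPV]
      exact .ballLELenPV _ ih
    · exact fun h => .of_isSharplyBoundedPV (h.subst σ)
    · exact fun _ ih => .of_isSigmabPV ih
    · intro i n φ ψ _ _ ih₁ ih₂
      rw [subst_imp]
      exact .imp ih₁ ih₂
    · intro i n t φ _ ih
      rw [subst_ballLE]
      exact .ballLE _ ih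
    · intro i n t φ _ ih
      rw [subst_bexLELenPV]
      exact .bexLELenPV _ ih

/-- `Σᵇᵢ(PV)` is stable under substitution of terms for the free variables (Buss 1986, §2.1,
Ch. 6). [cite: Buss1986, §2.1] -/
theorem IsSigmabPV.subst {i : ℕ} {φ : Language.pv.BoundedFormula α n}
    (h : IsSigmabPV i φ) (σ : α → Language.pv.Term β) : IsSigmabPV i (φ.subst σ) :=
  (IsSigmabPV.subst_and_IsPibPV_subst i σ).1 h

/-- `Πᵇᵢ(PV)` is stable under substitution of terms for the free variables (Buss 1986, §2.1,
Ch. 6). [cite: Buss1986, §2.1] -/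
theorem IsPibPV.subst {i : ℕ} {φ : Language.pv.BoundedFormula α n}
    (h : IsPibPV i φ) (σ : α → Language.pv.Term β) : IsPibPV i (φ.subst σ) :=
  (IsSigmabPV.subst_and_IsPibPV_subst i σ).2 h

end Subst

/-! ## Definable predicates and functions with parameters -/

section Env

variable {M : Type} {m : ℕ}

/-- The assignment naming every parameter `a ∈ M` by itself and the `j`-th argument variable by
`xs j` (as `argEnv` of `BoundedArithDefinability.lean`). [folklore] -/
abbrev pvEnv (xs : Fin m → M) : M ⊕ Fin m → M := Sum.elim id xs

/-- Renaming of the argument variables along `g`, parameters fixed. [folklore] -/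
def pvArgMap {m' : ℕ} (g : Fin m' → Fin m) : M ⊕ Fin m' → M ⊕ Fin m := Sum.map id g

/-- `pvEnv xs ∘ pvArgMap g = pvEnv (xs ∘ g)`. [folklore] -/
@[simp] theorem pvEnv_comp_pvArgMap {m' : ℕ} (g : Fin m' → Fin m) (xs : Fin m → M) :
    pvEnv xs ∘ pvArgMap g = pvEnv (xs ∘ g) := by
  funext x; rcases x with a | j <;> rfl

/-- The substitution instantiating the last argument variable by the `L(PV)`-term `t` (in the
other arguments and parameters). [folklore] -/
def pvSnocSubst (t : Language.pv.Term (M ⊕ Fin m)) :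
    M ⊕ Fin (m + 1) → Language.pv.Term (M ⊕ Fin m) :=
  Sum.elim (fun a => var (Sum.inl a)) (Fin.lastCases t fun j => var (Sum.inr j))

/-- The relabelling moving the last argument variable into the (single) context variable, used
to bind it by a bounded quantifier. [folklore] -/
def pvBindLast : M ⊕ Fin (m + 1) → (M ⊕ Fin m) ⊕ Fin 1 :=
  Sum.elim (Sum.inl ∘ Sum.inl) (Fin.lastCases (Sum.inr 0) fun j => Sum.inl (Sum.inr j))

/-- Semantics of `pvBindLast`: the assignment seen by a formula relabelled along it. [folklore] -/
theorem elim_comp_pvBindLast (xs : Fin m → M) (y : Fin (1 + 0) → M) :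
    Sum.elim (pvEnv xs) (y ∘ Fin.castAdd 0) ∘ pvBindLast = pvEnv (Fin.snoc xs (y 0)) := by
  funext x
  rcases x with a | j
  · rfl
  · cases j using Fin.lastCases with
    | last => simp [pvBindLast]
    | cast j => simp [pvBindLast]

end Env

section Definability

variable {M : Type} [Language.pv.Structure M] {m : ℕ}

/-- `IsPVTermFn F`: the function `F : Mᵐ → M` is given by an `L(PV)`-term with parameters from
`M` (Buss 1986, §2.2, Ch. 6: terms with parameters). [cite: Buss1986, §2.2] -/
def IsPVTermFn (F : (Fin m → M) → M) : Prop :=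
  ∃ t : Language.pv.Term (M ⊕ Fin m), ∀ xs, F xs = t.realize (pvEnv xs)

/-- `IsQFPVDef P`: the predicate `P ⊆ Mᵐ` is definable by an open `L(PV)`-formula with
parameters from `M` (Buss 1986, §2.1, Ch. 6). [cite: Buss1986, §2.1] -/
def IsQFPVDef (P : (Fin m → M) → Prop) : Prop :=
  ∃ φ : Language.pv.Formula (M ⊕ Fin m), φ.IsQF ∧ ∀ xs, P xs ↔ φ.Realize (pvEnv xs)

/-- `IsSigmabPVDef i P`: the predicate `P ⊆ Mᵐ` is definable by a `Σᵇᵢ(PV)` formula with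
parameters from `M` — the formulas-with-parameters to which the schemes of `S₂ⁱ(PV)`, `T₂ⁱ(PV)`
apply (Buss 1986, §2.1, §2.4, Ch. 6). [cite: Buss1986, §2.1] -/
def IsSigmabPVDef (i : ℕ) (P : (Fin m → M) → Prop) : Prop :=
  ∃ φ : Language.pv.Formula (M ⊕ Fin m), IsSigmabPV i φ ∧ ∀ xs, P xs ↔ φ.Realize (pvEnv xs)

/-- `IsPibPVDef i P`: the predicate `P ⊆ Mᵐ` is definable by a `Πᵇᵢ(PV)` formula with
parameters from `M` (Buss 1986, §2.1, Ch. 6). [cite: Buss1986, §2.1] -/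
def IsPibPVDef (i : ℕ) (P : (Fin m → M) → Prop) : Prop :=
  ∃ φ : Language.pv.Formula (M ⊕ Fin m), IsPibPV i φ ∧ ∀ xs, P xs ↔ φ.Realize (pvEnv xs)

/-- Semantics of `pvSnocSubst`, pointwise. [folklore] -/
@[simp] theorem realize_pvSnocSubst_apply (t : Language.pv.Term (M ⊕ Fin m)) (xs : Fin m → M)
    (x : M ⊕ Fin (m + 1)) :
    (pvSnocSubst t x).realize (pvEnv xs) = pvEnv (Fin.snoc xs (t.realize (pvEnv xs))) x := by
  rcases x with a | j
  · rfl
  · cases j using Fin.lastCases with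
    | last => simp [pvSnocSubst]
    | cast j => simp [pvSnocSubst]

/-- Semantics of `pvSnocSubst`. [folklore] -/
theorem realize_pvSnocSubst (t : Language.pv.Term (M ⊕ Fin m)) (xs : Fin m → M) :
    (fun x => (pvSnocSubst t x).realize (pvEnv xs)) =
      pvEnv (Fin.snoc xs (t.realize (pvEnv xs))) :=
  funext (realize_pvSnocSubst_apply t xs)

/-- Semantics of relabelling along `pvBindLast`. [folklore] -/
theorem realize_relabel_pvBindLast (φ : Language.pv.Formula (M ⊕ Fin (m + 1)))
    (xs : Fin m → M) (a : M) :
    (BoundedFormula.relabel (pvBindLast (M := M) (m := m)) φ).Realize (pvEnv xs)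
        (Fin.snoc (default : Fin 0 → M) a) ↔
      φ.Realize (pvEnv (Fin.snoc xs a)) := by
  rw [realize_relabel, elim_comp_pvBindLast]
  have h0 : (Fin.snoc (default : Fin 0 → M) a : Fin 1 → M) 0 = a := Fin.snoc_last _ _
  simp only [Formula.Realize, h0]
  exact Iff.of_eq (congrArg _ (Subsingleton.elim _ _))

/-! ### Term functions -/

namespace IsPVTermFn

/-- Projections are term functions. [folklore] -/
theorem proj (j : Fin m) : IsPVTermFn (fun xs : Fin m → M => xs j) :=
  ⟨var (Sum.inr j), fun _ => rfl⟩

/-- Constants (parameters) are term functions. [folklore] -/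
theorem const (a : M) : IsPVTermFn (fun _ : Fin m → M => a) :=
  ⟨var (Sum.inl a), fun _ => rfl⟩

/-- `0` is a term function. [folklore] -/
theorem zero : IsPVTermFn (fun _ : Fin m → M => mZero M) :=
  ⟨0, fun xs => (realize_pv_zero' (pvEnv xs)).symm⟩

variable {F G : (Fin m → M) → M}

/-- Transfer of term-definability along an extensional equality. [folklore] -/
theorem of_eq (hF : IsPVTermFn F) (h : ∀ xs, F xs = G xs) : IsPVTermFn G := by
  obtain ⟨t, ht⟩ := hF
  exact ⟨t, fun xs => (h xs).symm.trans (ht xs)⟩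

/-- Term functions are closed under `S`. [folklore] -/
theorem succ (hF : IsPVTermFn F) : IsPVTermFn fun xs => mSucc (F xs) := by
  obtain ⟨t, ht⟩ := hF
  exact ⟨pvSucc t, fun xs => by simp only [realize_pvSucc', ht]⟩

/-- Term functions are closed under `⌊·/2⌋`. [folklore] -/
theorem half (hF : IsPVTermFn F) : IsPVTermFn fun xs => mHalf (F xs) := by
  obtain ⟨t, ht⟩ := hF
  exact ⟨pvHalf t, fun xs => by simp only [realize_pvHalf', ht]⟩

/-- Term functions are closed under `|·|`. [folklore] -/
theorem len (hF : IsPVTermFn F) : IsPVTermFn fun xs => mLen (F xs) := by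
  obtain ⟨t, ht⟩ := hF
  exact ⟨pvLen t, fun xs => by simp only [realize_pvLen', ht]⟩

/-- Term functions are closed under `+`. [folklore] -/
theorem add (hF : IsPVTermFn F) (hG : IsPVTermFn G) :
    IsPVTermFn fun xs => mAdd (F xs) (G xs) := by
  obtain ⟨t, ht⟩ := hF
  obtain ⟨s, hs⟩ := hG
  exact ⟨t + s, fun xs => by simp only [realize_pv_add', ht, hs]⟩

/-- Term functions are closed under `·`. [folklore] -/
theorem mul (hF : IsPVTermFn F) (hG : IsPVTermFn G) :
    IsPVTermFn fun xs => mMul (F xs) (G xs) := by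
  obtain ⟨t, ht⟩ := hF
  obtain ⟨s, hs⟩ := hG
  exact ⟨t * s, fun xs => by simp only [realize_pv_mul', ht, hs]⟩

/-- Term functions are closed under `#`. [folklore] -/
theorem smash (hF : IsPVTermFn F) (hG : IsPVTermFn G) :
    IsPVTermFn fun xs => mSmash (F xs) (G xs) := by
  obtain ⟨t, ht⟩ := hF
  obtain ⟨s, hs⟩ := hG
  exact ⟨pvSmash t s, fun xs => by simp only [realize_pvSmash', ht, hs]⟩

/-- Term functions are closed under renaming of arguments. [folklore] -/
theorem comp {m' : ℕ} {F : (Fin m' → M) → M} (hF : IsPVTermFn F) (g : Fin m' → Fin m) :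
    IsPVTermFn fun xs : Fin m → M => F (xs ∘ g) := by
  obtain ⟨t, ht⟩ := hF
  refine ⟨t.relabel (pvArgMap g), fun xs => ?_⟩
  dsimp only
  rw [Term.realize_relabel, pvEnv_comp_pvArgMap, ht]

/-- Term functions are closed under substitution of a term function for the last argument.
[folklore] -/
theorem snoc {F : (Fin (m + 1) → M) → M} (hF : IsPVTermFn F) (hG : IsPVTermFn G) :
    IsPVTermFn fun xs : Fin m → M => F (Fin.snoc xs (G xs)) := by
  obtain ⟨t, ht⟩ := hF
  obtain ⟨s, hs⟩ := hG
  refine ⟨t.subst (pvSnocSubst s), fun xs => ?_⟩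
  dsimp only
  rw [Term.realize_subst, realize_pvSnocSubst, ← hs, ht]

end IsPVTermFn

/-! ### Open definability -/

namespace IsQFPVDef

variable {P Q : (Fin m → M) → Prop} {F G : (Fin m → M) → M}

/-- `F x̄ ≤ G x̄` is open-definable for term functions `F`, `G`. [folklore] -/
theorem le (hF : IsPVTermFn F) (hG : IsPVTermFn G) : IsQFPVDef fun xs => MLe (F xs) (G xs) := by
  obtain ⟨t, ht⟩ := hF
  obtain ⟨s, hs⟩ := hG
  refine ⟨Term.le (t.relabel Sum.inl) (s.relabel Sum.inl), ?_, fun xs => ?_⟩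
  · exact (BoundedFormula.IsAtomic.rel _ _).isQF
  · dsimp only
    rw [ht, hs]
    simp [Formula.Realize]

/-- `F x̄ = G x̄` is open-definable for term functions `F`, `G`. [folklore] -/
theorem eq (hF : IsPVTermFn F) (hG : IsPVTermFn G) : IsQFPVDef fun xs => F xs = G xs := by
  obtain ⟨t, ht⟩ := hF
  obtain ⟨s, hs⟩ := hG
  refine ⟨Term.equal t s, (BoundedFormula.IsAtomic.equal _ _).isQF, fun xs => ?_⟩
  dsimp only
  rw [ht, hs]
  simp

/-- Transfer of open definability along an extensional equivalence. [folklore] -/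
theorem of_iff (hP : IsQFPVDef P) (h : ∀ xs, P xs ↔ Q xs) : IsQFPVDef Q := by
  obtain ⟨φ, hφ, hP⟩ := hP
  exact ⟨φ, hφ, fun xs => (h xs).symm.trans (hP xs)⟩

/-- Open-definable predicates are closed under negation. [folklore] -/
theorem not (hP : IsQFPVDef P) : IsQFPVDef fun xs => ¬P xs := by
  obtain ⟨φ, hφ, h⟩ := hP
  exact ⟨∼φ, hφ.not, fun xs => by simp [h]⟩

/-- Open-definable predicates are closed under conjunction. [folklore] -/
theorem and (hP : IsQFPVDef P) (hQ : IsQFPVDef Q) : IsQFPVDef fun xs => P xs ∧ Q xs := by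
  obtain ⟨φ, hφ, h⟩ := hP
  obtain ⟨ψ, hψ, h'⟩ := hQ
  exact ⟨φ ⊓ ψ, hφ.inf hψ, fun xs => by simp [h, h']⟩

/-- Open-definable predicates are closed under implication. [folklore] -/
theorem imp (hP : IsQFPVDef P) (hQ : IsQFPVDef Q) : IsQFPVDef fun xs => P xs → Q xs := by
  obtain ⟨φ, hφ, h⟩ := hP
  obtain ⟨ψ, hψ, h'⟩ := hQ
  exact ⟨φ ⟹ ψ, hφ.imp hψ, fun xs => by simp [h, h']⟩

/-- Open-definable predicates are closed under renaming of arguments. [folklore] -/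
theorem comp {m' : ℕ} {P : (Fin m' → M) → Prop} (hP : IsQFPVDef P) (g : Fin m' → Fin m) :
    IsQFPVDef fun xs : Fin m → M => P (xs ∘ g) := by
  obtain ⟨φ, hφ, h⟩ := hP
  refine ⟨φ.relabel (pvArgMap g), hφ.relabel _, fun xs => ?_⟩
  dsimp only
  rw [h, Formula.realize_relabel, pvEnv_comp_pvArgMap]

/-- Open-definable predicates are closed under substitution of a term function for the last
argument. [folklore] -/
theorem snoc {P : (Fin (m + 1) → M) → Prop} (hP : IsQFPVDef P) (hG : IsPVTermFn G) :
    IsQFPVDef fun xs : Fin m → M => P (Fin.snoc xs (G xs)) := by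
  obtain ⟨φ, hφ, h⟩ := hP
  obtain ⟨s, hs⟩ := hG
  refine ⟨φ.subst (pvSnocSubst s), isQF_subst hφ _, fun xs => ?_⟩
  dsimp only
  rw [h]
  simp only [Formula.Realize, realize_subst, realize_pvSnocSubst, ← hs]

/-- Substituting a term function into a unary open-definable predicate. [folklore] -/
theorem comp₁ {P : M → Prop} (hP : IsQFPVDef fun v : Fin 1 → M => P (v 0)) (hF : IsPVTermFn F) :
    IsQFPVDef fun xs => P (F xs) :=
  ((hP.comp fun _ : Fin 1 => Fin.last m).snoc hF).of_iff fun xs => by simp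

end IsQFPVDef

/-! ### `Σᵇᵢ(PV)`- and `Πᵇᵢ(PV)`-definability: all levels -/

section Levels

variable {i j : ℕ} {P Q : (Fin m → M) → Prop} {F G : (Fin m → M) → M}

/-- Transfer of `Σᵇᵢ(PV)`-definability along an extensional equivalence. [folklore] -/
theorem IsSigmabPVDef.of_iff (hP : IsSigmabPVDef i P) (h : ∀ xs, P xs ↔ Q xs) :
    IsSigmabPVDef i Q := by
  obtain ⟨φ, hφ, hP⟩ := hP
  exact ⟨φ, hφ, fun xs => (h xs).symm.trans (hP xs)⟩

/-- Transfer of `Πᵇᵢ(PV)`-definability along an extensional equivalence. [folklore] -/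
theorem IsPibPVDef.of_iff (hP : IsPibPVDef i P) (h : ∀ xs, P xs ↔ Q xs) : IsPibPVDef i Q := by
  obtain ⟨φ, hφ, hP⟩ := hP
  exact ⟨φ, hφ, fun xs => (h xs).symm.trans (hP xs)⟩

/-- Open-definable predicates are `Σᵇᵢ(PV)`-definable for every `i` (open formulas are sharply
bounded, Buss 1986, §2.1, Ch. 6). [cite: Buss1986, §2.1] -/
theorem IsQFPVDef.isSigmabPVDef (hP : IsQFPVDef P) (i : ℕ) : IsSigmabPVDef i P := by
  obtain ⟨φ, hφ, h⟩ := hP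
  exact ⟨φ, .of_isSharplyBoundedPV (.of_isQF hφ), h⟩

/-- Open-definable predicates are `Πᵇᵢ(PV)`-definable for every `i` (Buss 1986, §2.1, Ch. 6).
[cite: Buss1986, §2.1] -/
theorem IsQFPVDef.isPibPVDef (hP : IsQFPVDef P) (i : ℕ) : IsPibPVDef i P := by
  obtain ⟨φ, hφ, h⟩ := hP
  exact ⟨φ, .of_isSharplyBoundedPV (.of_isQF hφ), h⟩

/-- `Πᵇᵢ(PV) ⊆ Σᵇᵢ₊₁(PV)` for definable predicates (Buss 1986, §2.1, Ch. 6). [cite: Buss1986, §2.1] -/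
theorem IsPibPVDef.isSigmabPVDef_succ (hP : IsPibPVDef i P) : IsSigmabPVDef (i + 1) P := by
  obtain ⟨φ, hφ, h⟩ := hP
  exact ⟨φ, hφ.isSigmabPV_succ, h⟩

/-- `Σᵇᵢ(PV) ⊆ Πᵇᵢ₊₁(PV)` for definable predicates (Buss 1986, §2.1, Ch. 6). [cite: Buss1986, §2.1] -/
theorem IsSigmabPVDef.isPibPVDef_succ (hP : IsSigmabPVDef i P) : IsPibPVDef (i + 1) P := by
  obtain ⟨φ, hφ, h⟩ := hP
  exact ⟨φ, hφ.isPibPV_succ, h⟩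

/-- Cumulativity `Σᵇᵢ(PV) ⊆ Σᵇⱼ(PV)` (`i ≤ j`) for definable predicates (Buss 1986, §2.1, Ch. 6).
[cite: Buss1986, §2.1] -/
theorem IsSigmabPVDef.mono (hP : IsSigmabPVDef i P) (hij : i ≤ j) : IsSigmabPVDef j P := by
  obtain ⟨φ, hφ, h⟩ := hP
  exact ⟨φ, IsSigmabPV.mono_holds hij hφ, h⟩

/-- Cumulativity `Πᵇᵢ(PV) ⊆ Πᵇⱼ(PV)` (`i ≤ j`) for definable predicates (Buss 1986, §2.1, Ch. 6).
[cite: Buss1986, §2.1] -/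
theorem IsPibPVDef.mono (hP : IsPibPVDef i P) (hij : i ≤ j) : IsPibPVDef j P := by
  obtain ⟨φ, hφ, h⟩ := hP
  exact ⟨φ, IsPibPV.mono_holds hij hφ, h⟩

/-- `Σᵇᵢ(PV)`-definable predicates are closed under renaming of arguments (Buss 1986, §2.1,
Ch. 6). [cite: Buss1986, §2.1] -/
theorem IsSigmabPVDef.comp {m' : ℕ} {P : (Fin m' → M) → Prop} (hP : IsSigmabPVDef i P)
    (g : Fin m' → Fin m) : IsSigmabPVDef i fun xs : Fin m → M => P (xs ∘ g) := by
  obtain ⟨φ, hφ, h⟩ := hP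
  refine ⟨φ.relabel (pvArgMap g), hφ.formulaRelabel _, fun xs => ?_⟩
  dsimp only
  rw [h, Formula.realize_relabel, pvEnv_comp_pvArgMap]

/-- `Πᵇᵢ(PV)`-definable predicates are closed under renaming of arguments (Buss 1986, §2.1,
Ch. 6). [cite: Buss1986, §2.1] -/
theorem IsPibPVDef.comp {m' : ℕ} {P : (Fin m' → M) → Prop} (hP : IsPibPVDef i P)
    (g : Fin m' → Fin m) : IsPibPVDef i fun xs : Fin m → M => P (xs ∘ g) := by
  obtain ⟨φ, hφ, h⟩ := hP
  refine ⟨φ.relabel (pvArgMap g), hφ.formulaRelabel _, fun xs => ?_⟩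
  dsimp only
  rw [h, Formula.realize_relabel, pvEnv_comp_pvArgMap]

/-- `Σᵇᵢ(PV)`-definable predicates are closed under substitution of a term function for the
last argument (Buss 1986, §2.1, Ch. 6: closure under term substitution). [cite: Buss1986, §2.1] -/
theorem IsSigmabPVDef.snoc {P : (Fin (m + 1) → M) → Prop} (hP : IsSigmabPVDef i P)
    (hG : IsPVTermFn G) : IsSigmabPVDef i fun xs : Fin m → M => P (Fin.snoc xs (G xs)) := by
  obtain ⟨φ, hφ, h⟩ := hP
  obtain ⟨s, hs⟩ := hG
  refine ⟨φ.subst (pvSnocSubst s), hφ.subst _, fun xs => ?_⟩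
  dsimp only
  rw [h]
  simp only [Formula.Realize, realize_subst, realize_pvSnocSubst, ← hs]

/-- `Πᵇᵢ(PV)`-definable predicates are closed under substitution of a term function for the
last argument (Buss 1986, §2.1, Ch. 6). [cite: Buss1986, §2.1] -/
theorem IsPibPVDef.snoc {P : (Fin (m + 1) → M) → Prop} (hP : IsPibPVDef i P)
    (hG : IsPVTermFn G) : IsPibPVDef i fun xs : Fin m → M => P (Fin.snoc xs (G xs)) := by
  obtain ⟨φ, hφ, h⟩ := hP
  obtain ⟨s, hs⟩ := hG
  refine ⟨φ.subst (pvSnocSubst s), hφ.subst _, fun xs => ?_⟩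
  dsimp only
  rw [h]
  simp only [Formula.Realize, realize_subst, realize_pvSnocSubst, ← hs]

/-- Substituting a term function into a unary `Σᵇᵢ(PV)`-definable predicate. [folklore] -/
theorem IsSigmabPVDef.comp₁ {P : M → Prop} (hP : IsSigmabPVDef i fun v : Fin 1 → M => P (v 0))
    (hF : IsPVTermFn F) : IsSigmabPVDef i fun xs => P (F xs) :=
  ((hP.comp fun _ : Fin 1 => Fin.last m).snoc hF).of_iff fun xs => by simp

/-- Substituting a term function into a unary `Πᵇᵢ(PV)`-definable predicate. [folklore] -/
theorem IsPibPVDef.comp₁ {P : M → Prop} (hP : IsPibPVDef i fun v : Fin 1 → M => P (v 0))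
    (hF : IsPVTermFn F) : IsPibPVDef i fun xs => P (F xs) :=
  ((hP.comp fun _ : Fin 1 => Fin.last m).snoc hF).of_iff fun xs => by simp

end Levels

/-! ### Closure properties at successor levels `Σᵇᵢ₊₁(PV)`, `Πᵇᵢ₊₁(PV)` -/

section Succ

variable {i : ℕ} {P Q : (Fin m → M) → Prop}

/-- Negations of `Πᵇᵢ₊₁(PV)`-definable predicates are `Σᵇᵢ₊₁(PV)`-definable (Buss 1986, §2.1,
Ch. 6). [cite: Buss1986, §2.1] -/
theorem IsPibPVDef.not (hP : IsPibPVDef (i + 1) P) : IsSigmabPVDef (i + 1) fun xs => ¬P xs := by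
  obtain ⟨φ, hφ, h⟩ := hP
  exact ⟨∼φ, hφ.not, fun xs => by simp [h]⟩

/-- Negations of `Σᵇᵢ₊₁(PV)`-definable predicates are `Πᵇᵢ₊₁(PV)`-definable (Buss 1986, §2.1,
Ch. 6). [cite: Buss1986, §2.1] -/
theorem IsSigmabPVDef.not (hP : IsSigmabPVDef (i + 1) P) : IsPibPVDef (i + 1) fun xs => ¬P xs := by
  obtain ⟨φ, hφ, h⟩ := hP
  exact ⟨∼φ, hφ.not, fun xs => by simp [h]⟩

/-- `Σᵇᵢ₊₁(PV)`-definable predicates are closed under conjunction (Buss 1986, §2.1, Ch. 6).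
[cite: Buss1986, §2.1] -/
theorem IsSigmabPVDef.and (hP : IsSigmabPVDef (i + 1) P) (hQ : IsSigmabPVDef (i + 1) Q) :
    IsSigmabPVDef (i + 1) fun xs => P xs ∧ Q xs := by
  obtain ⟨φ, hφ, h⟩ := hP
  obtain ⟨ψ, hψ, h'⟩ := hQ
  exact ⟨φ ⊓ ψ, hφ.inf hψ, fun xs => by simp [h, h']⟩

/-- `Σᵇᵢ₊₁(PV)`-definable predicates are closed under disjunction (Buss 1986, §2.1, Ch. 6).
[cite: Buss1986, §2.1] -/
theorem IsSigmabPVDef.or (hP : IsSigmabPVDef (i + 1) P) (hQ : IsSigmabPVDef (i + 1) Q) :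
    IsSigmabPVDef (i + 1) fun xs => P xs ∨ Q xs := by
  obtain ⟨φ, hφ, h⟩ := hP
  obtain ⟨ψ, hψ, h'⟩ := hQ
  exact ⟨φ ⊔ ψ, hφ.sup hψ, fun xs => by simp [h, h']⟩

/-- `Πᵇᵢ₊₁(PV)`-definable predicates are closed under conjunction (Buss 1986, §2.1, Ch. 6).
[cite: Buss1986, §2.1] -/
theorem IsPibPVDef.and (hP : IsPibPVDef (i + 1) P) (hQ : IsPibPVDef (i + 1) Q) :
    IsPibPVDef (i + 1) fun xs => P xs ∧ Q xs := by
  obtain ⟨φ, hφ, h⟩ := hP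
  obtain ⟨ψ, hψ, h'⟩ := hQ
  exact ⟨φ ⊓ ψ, hφ.inf hψ, fun xs => by simp [h, h']⟩

/-- An implication `P → Q` with `P ∈ Πᵇᵢ₊₁(PV)`, `Q ∈ Σᵇᵢ₊₁(PV)` is `Σᵇᵢ₊₁(PV)`-definable
(Buss 1986, §2.1, Ch. 6). [cite: Buss1986, §2.1] -/
theorem IsSigmabPVDef.imp (hP : IsPibPVDef (i + 1) P) (hQ : IsSigmabPVDef (i + 1) Q) :
    IsSigmabPVDef (i + 1) fun xs => P xs → Q xs := by
  obtain ⟨φ, hφ, h⟩ := hP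
  obtain ⟨ψ, hψ, h'⟩ := hQ
  exact ⟨φ ⟹ ψ, .imp hφ hψ, fun xs => by simp [h, h']⟩

/-- An implication `P → Q` with `P ∈ Σᵇᵢ₊₁(PV)`, `Q ∈ Πᵇᵢ₊₁(PV)` is `Πᵇᵢ₊₁(PV)`-definable
(Buss 1986, §2.1, Ch. 6). [cite: Buss1986, §2.1] -/
theorem IsPibPVDef.imp (hP : IsSigmabPVDef (i + 1) P) (hQ : IsPibPVDef (i + 1) Q) :
    IsPibPVDef (i + 1) fun xs => P xs → Q xs := by
  obtain ⟨φ, hφ, h⟩ := hP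
  obtain ⟨ψ, hψ, h'⟩ := hQ
  exact ⟨φ ⟹ ψ, .imp hφ hψ, fun xs => by simp [h, h']⟩

variable {R : (Fin (m + 1) → M) → Prop} {B : (Fin m → M) → M}

/-- **Bounded `∃`.** `Σᵇᵢ₊₁(PV)`-definable predicates are closed under bounded existential
quantification `∃ y ≤ t(x̄)` with `t` an `L(PV)`-term (Buss 1986, §2.1, Ch. 6). [cite: Buss1986, §2.1] -/
theorem IsSigmabPVDef.bexLE (hR : IsSigmabPVDef (i + 1) R) (hB : IsPVTermFn B) :
    IsSigmabPVDef (i + 1) fun xs => ∃ y, MLe y (B xs) ∧ R (Fin.snoc xs y) := by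
  obtain ⟨φ, hφ, h⟩ := hR
  obtain ⟨t, ht⟩ := hB
  refine ⟨Literature.Computability.MetaComplexity.bexLE (t.relabel Sum.inl)
    (BoundedFormula.relabel pvBindLast φ), .bexLE _ (hφ.relabel _), fun xs => ?_⟩
  dsimp only
  simp only [Formula.Realize, realize_bexLE_pv', Term.realize_relabel, Sum.elim_comp_inl, ← ht]
  refine exists_congr fun y => and_congr_right fun _ => ?_
  rw [h, ← realize_relabel_pvBindLast φ xs y]

/-- **Bounded `∀`.** `Πᵇᵢ₊₁(PV)`-definable predicates are closed under bounded universal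
quantification `∀ y ≤ t(x̄)` (Buss 1986, §2.1, Ch. 6). [cite: Buss1986, §2.1] -/
theorem IsPibPVDef.ballLE (hR : IsPibPVDef (i + 1) R) (hB : IsPVTermFn B) :
    IsPibPVDef (i + 1) fun xs => ∀ y, MLe y (B xs) → R (Fin.snoc xs y) := by
  obtain ⟨φ, hφ, h⟩ := hR
  obtain ⟨t, ht⟩ := hB
  refine ⟨Literature.Computability.MetaComplexity.ballLE (t.relabel Sum.inl)
    (BoundedFormula.relabel pvBindLast φ), .ballLE _ (hφ.relabel _), fun xs => ?_⟩
  dsimp only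
  simp only [Formula.Realize, realize_ballLE_pv', Term.realize_relabel, Sum.elim_comp_inl, ← ht]
  refine forall_congr' fun y => imp_congr_right fun _ => ?_
  rw [h, ← realize_relabel_pvBindLast φ xs y]

/-- **Sharply bounded `∀`.** `Σᵇᵢ₊₁(PV)`-definable predicates are closed under sharply bounded
universal quantification `∀ y ≤ |t(x̄)|` (Buss 1986, §2.1, Ch. 6). [cite: Buss1986, §2.1] -/
theorem IsSigmabPVDef.ballLELen (hR : IsSigmabPVDef (i + 1) R) (hB : IsPVTermFn B) :
    IsSigmabPVDef (i + 1) fun xs => ∀ y, MLe y (mLen (B xs)) → R (Fin.snoc xs y) := by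
  obtain ⟨φ, hφ, h⟩ := hR
  obtain ⟨t, ht⟩ := hB
  refine ⟨ballLELenPV (t.relabel Sum.inl) (BoundedFormula.relabel pvBindLast φ),
    .ballLELenPV _ (hφ.relabel _), fun xs => ?_⟩
  dsimp only
  simp only [ballLELenPV, Formula.Realize, realize_ballLE_pv', realize_pvLen',
    Term.realize_relabel, Sum.elim_comp_inl, ← ht]
  refine forall_congr' fun y => imp_congr_right fun _ => ?_
  rw [h, ← realize_relabel_pvBindLast φ xs y]

/-- **Sharply bounded `∃`.** `Πᵇᵢ₊₁(PV)`-definable predicates are closed under sharply bounded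
existential quantification `∃ y ≤ |t(x̄)|` (Buss 1986, §2.1, Ch. 6). [cite: Buss1986, §2.1] -/
theorem IsPibPVDef.bexLELen (hR : IsPibPVDef (i + 1) R) (hB : IsPVTermFn B) :
    IsPibPVDef (i + 1) fun xs => ∃ y, MLe y (mLen (B xs)) ∧ R (Fin.snoc xs y) := by
  obtain ⟨φ, hφ, h⟩ := hR
  obtain ⟨t, ht⟩ := hB
  refine ⟨bexLELenPV (t.relabel Sum.inl) (BoundedFormula.relabel pvBindLast φ),
    .bexLELenPV _ (hφ.relabel _), fun xs => ?_⟩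
  dsimp only
  simp only [bexLELenPV, Formula.Realize, realize_bexLE_pv', realize_pvLen',
    Term.realize_relabel, Sum.elim_comp_inl, ← ht]
  refine exists_congr fun y => and_congr_right fun _ => ?_
  rw [h, ← realize_relabel_pvBindLast φ xs y]

end Succ

/-! ### The induction schemes for definable predicates -/

section Induction

variable {i k : ℕ}

/-- A `Σᵇᵢ(PV)` formula `ψ(p̄, x)` with variables `Fin (k + 1)`, at fixed parameters `p̄ ∈ Mᵏ`,
defines a `Σᵇᵢ(PV)`-definable (with parameters) unary predicate of its last variable
(Buss 1986, §2.1, Ch. 6: formulas with parameters). [cite: Buss1986, §2.1] -/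
theorem IsSigmabPV.isSigmabPVDef_realize_snoc {ψ : Language.pv.Formula (Fin (k + 1))}
    (hψ : IsSigmabPV i ψ) (p : Fin k → M) :
    IsSigmabPVDef i fun v : Fin 1 → M => ψ.Realize (Fin.snoc p (v 0)) := by
  refine ⟨ψ.relabel (Fin.lastCases (Sum.inr 0) fun l => Sum.inl (p l)), hψ.formulaRelabel _,
    fun xs => ?_⟩
  have h : (Fin.snoc p (xs 0) : Fin (k + 1) → M) =
      pvEnv xs ∘ Fin.lastCases (Sum.inr 0) fun l => Sum.inl (p l) := by
    funext l
    cases l using Fin.lastCases with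
    | last => simp
    | cast l => simp
  rw [Formula.realize_relabel, ← h]

/-- A `Σᵇᵢ(PV)`-definable (with parameters) unary predicate is an instance, at finitely many
parameters `p̄ ∈ Mᵏ`, of a `Σᵇᵢ(PV)` formula with variables `Fin (k + 1)` — the shape to which
the induction axioms `pvIndAxiom`, `pvPindAxiom` apply: enumerate the finitely many parameters
that occur. [folklore] -/
theorem exists_formula_fin_of_isSigmabPVDef {P : (Fin 1 → M) → Prop} (hP : IsSigmabPVDef i P) :
    ∃ (k : ℕ) (ψ : Language.pv.Formula (Fin (k + 1))) (p : Fin k → M),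
      IsSigmabPV i ψ ∧ ∀ a, P ![a] ↔ ψ.Realize (Fin.snoc p a) := by
  classical
  obtain ⟨φ, hφ, h⟩ := hP
  let S : Finset (M ⊕ Fin 1) := φ.freeVarFinset
  let k : ℕ := S.card
  let e : ↥S ≃ Fin k := S.equivFin
  let g : M ⊕ Fin 1 → Fin (k + 1) := fun x =>
    Sum.elim (fun a => if hx : (Sum.inl a : M ⊕ Fin 1) ∈ S then Fin.castSucc (e ⟨Sum.inl a, hx⟩)
      else Fin.last k) (fun _ => Fin.last k) x
  let p : Fin k → M := fun j => Sum.elim id (fun _ => mZero M) (e.symm j).1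
  refine ⟨k, φ.relabel g, p, hφ.formulaRelabel g, fun a => ?_⟩
  rw [h, Formula.realize_relabel]
  refine realize_congr_freeVarFinset φ default fun x hx => ?_
  rcases x with b | j
  · have hb : (Sum.inl b : M ⊕ Fin 1) ∈ S := hx
    simp only [Function.comp_apply, g, Sum.elim_inl, dif_pos hb, Fin.snoc_castSucc, p,
      Equiv.symm_apply_apply]
  · have hj : j = 0 := Subsingleton.elim _ _
    subst hj
    simp [g]

/-- The `PIND` axiom of a `Σᵇᵢ(PV)` formula is an axiom of `S₂ⁱ(PV)` (Buss 1986, §2.4, Ch. 6).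
[cite: Buss1986, §2.4] -/
theorem pvPindAxiom_mem_S2PV {φ : Language.pv.Formula (Fin (k + 1))} (hφ : IsSigmabPV i φ) :
    pvPindAxiom φ ∈ S2PV i :=
  Or.inr (Set.mem_iUnion.2 ⟨k, Set.mem_image_of_mem _ hφ⟩)

/-- The `IND` axiom of a `Σᵇᵢ(PV)` formula is an axiom of `T₂ⁱ(PV)` (Buss 1986, §2.4, Ch. 6).
[cite: Buss1986, §2.4] -/
theorem pvIndAxiom_mem_T2PV {φ : Language.pv.Formula (Fin (k + 1))} (hφ : IsSigmabPV i φ) :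
    pvIndAxiom φ ∈ T2PV i :=
  Or.inr (Set.mem_iUnion.2 ⟨k, Set.mem_image_of_mem _ hφ⟩)

/-- **`Σᵇᵢ(PV)-PIND`** for definable predicates, in a structure satisfying the scheme
`Σᵇᵢ(PV)-PIND`: if `P ⊆ M` is `Σᵇᵢ(PV)`-definable with parameters, `P(0)` and
`∀a (P(⌊a/2⌋) → P(a))`, then `P = M` (Buss 1986, §2.4, Ch. 6). [cite: Buss1986, §2.4] -/
theorem IsSigmabPVDef.pinduction' (hM : M ⊨ ⋃ k, pvPindAxiom '' sigmabPVFormulas i k)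
    {P : M → Prop} (hP : IsSigmabPVDef i fun v : Fin 1 → M => P (v 0)) (h0 : P (mZero M))
    (hs : ∀ a, P (mHalf a) → P a) (a : M) : P a := by
  obtain ⟨k, ψ, p, hψ, h⟩ := exists_formula_fin_of_isSigmabPVDef hP
  have hax := (realize_pvPindAxiom_iff ψ).1
    (hM.realize_of_mem _ (Set.mem_iUnion.2 ⟨k, Set.mem_image_of_mem _ hψ⟩)) p
  simp only [← h] at hax
  exact hax h0 hs a

/-- **`Σᵇᵢ(PV)-IND`** for definable predicates, in a structure satisfying the scheme
`Σᵇᵢ(PV)-IND`: if `P ⊆ M` is `Σᵇᵢ(PV)`-definable with parameters, `P(0)` and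
`∀a (P(a) → P(Sa))`, then `P = M` (Buss 1986, §2.4, Ch. 6). [cite: Buss1986, §2.4] -/
theorem IsSigmabPVDef.induction' (hM : M ⊨ ⋃ k, pvIndAxiom '' sigmabPVFormulas i k)
    {P : M → Prop} (hP : IsSigmabPVDef i fun v : Fin 1 → M => P (v 0)) (h0 : P (mZero M))
    (hs : ∀ a, P a → P (mSucc a)) (a : M) : P a := by
  obtain ⟨k, ψ, p, hψ, h⟩ := exists_formula_fin_of_isSigmabPVDef hP
  have hax := (realize_pvIndAxiom_iff ψ).1
    (hM.realize_of_mem _ (Set.mem_iUnion.2 ⟨k, Set.mem_image_of_mem _ hψ⟩)) p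
  simp only [← h] at hax
  exact hax h0 hs a

/-- **`Σᵇᵢ(PV)-PIND` in models of `S₂ⁱ(PV)`** for definable predicates (Buss 1986, §2.4 and
Ch. 6, Definition of `S₂ⁱ(PV)`; Krajíček 1995, §5.3, p. 73). [cite: Buss1986, §2.4] -/
theorem IsSigmabPVDef.pinduction (hM : M ⊨ S2PV i) {P : M → Prop}
    (hP : IsSigmabPVDef i fun v : Fin 1 → M => P (v 0)) (h0 : P (mZero M))
    (hs : ∀ a, P (mHalf a) → P a) (a : M) : P a :=
  hP.pinduction' (hM.mono Set.subset_union_right) h0 hs a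

/-- **`Σᵇᵢ(PV)-IND` in models of `T₂ⁱ(PV)`** for definable predicates (Buss 1986, §2.4 and
Ch. 6, Definition of `T₂ⁱ(PV)`). [cite: Buss1986, §2.4] -/
theorem IsSigmabPVDef.induction (hM : M ⊨ T2PV i) {P : M → Prop}
    (hP : IsSigmabPVDef i fun v : Fin 1 → M => P (v 0)) (h0 : P (mZero M))
    (hs : ∀ a, P a → P (mSucc a)) (a : M) : P a :=
  hP.induction' (hM.mono Set.subset_union_right) h0 hs a

end Induction

end Definability

end Literature.Analysis.FunctionSpaces
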